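import Summits.BirchSwinnertonDyer.BirchSwinnertonDyer.Theses.GenusKolyvaginAtTwo
import Summits.BirchSwinnertonDyer.BirchSwinnertonDyer.Theses.ByReductionTypeAtTwo
import HarnessLib

/-!
# Route `GenusKolyvaginAtTwo`: every declared RANK-ZERO residual of the route is dominated BY NAME by WALL row 1 (route ByReductionTypeAtTwo,
# items 19095–19098) — `OffCutResidualAtTwoR` (stmt-31767, binder `hOff` of `closes`), its retired predecessor `OffCutResidualAtTwo` (32095) and
# `AdditiveOnlyResidualAtTwoNegDisc` (24826); the rank-`0` part of `OffHabitatResidualAtTwo` (22139) is LEAD g27's `GenusExact.Census.bsdp_rankZero_of_wallRows`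

Seat `bsd-line-gk2-p2` g28 (PROVER seat 2/3, cell `bsd-f1-sign2`), `--supports stmt-BirchSwinnertonDyer-31767` (helper; closes nothing — the WALL rows
are OPEN items of a sibling route).  THEOREMS ONLY (no definition, no named fact, no `sorry`); standard axioms.  **BSD is NOT proved by this file; no
residual and no WALL row is proved; no item is closed.**

THE POINT (census hygiene, director (657)(d) «rank-0 BSD₂ at 2 is staffed ONCE, on the WALL rows»).  Each of these residuals concludes `BSDp W 2` for a
NON-CM globally minimal `W` of ANALYTIC RANK `0` under further (idle) cell conditions; WALL row 1 is `BSD₂` for EVERY non-CM globally minimal curve of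
analytic rank `0`, by the reduction-type tetrachotomy at `2`.  So each residual is ONE LINE from the four WALL items (LEAD g27's `GenusExact.Census`
proved the leaf-level statement `NonCMAtTwo ⟺ WALL ∧ 22139`, p783309; this file spells out the item-level closers the ledger can cite).  Nothing here is
progress on BSD.

References: [Miller2011LMS] Def. 1.1 (BSD(E,p)).
-/

set_option autoImplicit false
set_option linter.dupNamespace false -- `Summit.<P>.<Sub>` repeats `BirchSwinnertonDyer` (D-0017)

noncomputable section

open scoped Classical

namespace Summit.BirchSwinnertonDyer.BirchSwinnertonDyer.Theorems.GenusExact.Census.RankZeroResiduals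

open WeierstrassCurve Literature.NumberTheory.EllipticCurves
open Summit.BirchSwinnertonDyer.BirchSwinnertonDyer.Theses.GenusKolyvaginAtTwo
open Summit.BirchSwinnertonDyer.BirchSwinnertonDyer.Theses.ByReductionTypeAtTwo
  (GoodOrdinaryRankZeroAtTwo MultiplicativeRankZeroAtTwo SupersingularRankZeroAtTwo AdditiveRankZeroAtTwo)

/-- **`OffCutResidualAtTwoR` (stmt-BirchSwinnertonDyer-31767, binder `hOff` of `closes`) ⟸ WALL row 1, BY NAME**: its curves are non-CM of analytic
rank `0`; the cut clauses are idle.  (Tetrachotomy inlined; same statement-shape as `GenusExact.Census.bsdp_rankZero_of_wallRows`.)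
CONDITIONAL on the four OPEN WALL items; closes nothing. [cite: Miller2011LMS, Def. 1.1] -/
theorem offCutResidualAtTwoR_of_wallRows (hOrd : GoodOrdinaryRankZeroAtTwo) (hMult : MultiplicativeRankZeroAtTwo)
    (hSS : SupersingularRankZeroAtTwo) (hAdd : AdditiveRankZeroAtTwo) : OffCutResidualAtTwoR := by
  intro W _ _ _ hcm hr0 _hρ _hT _hopt _hoff
  by_cases hg : W.HasGoodReductionAtPrime 2
  · by_cases hd : ((2 : ℕ) : ℤ) ∣ W.frobeniusTrace 2
    · exact hSS W hcm hr0 ⟨hg, hd⟩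
    · exact hOrd W hcm hr0 ⟨hg, hd⟩
  · by_cases hm : W.HasMultiplicativeReductionAtPrime 2
    · exact hMult W hcm hr0 hm
    · exact hAdd W hcm hr0 ⟨hg, hm⟩

/-- **`OffCutResidualAtTwo` (stmt-BirchSwinnertonDyer-32095, the retired rev-49–56 text kept as an aside) ⟸ WALL row 1, BY NAME** (rank `0`, non-CM; cut
clauses idle).  CONDITIONAL; closes nothing. [cite: Miller2011LMS, Def. 1.1] -/
theorem offCutResidualAtTwo_of_wallRows (hOrd : GoodOrdinaryRankZeroAtTwo) (hMult : MultiplicativeRankZeroAtTwo)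
    (hSS : SupersingularRankZeroAtTwo) (hAdd : AdditiveRankZeroAtTwo) : OffCutResidualAtTwo := by
  intro W _ _ _ hcm hr0 _hρ _hT _hopt _hoff
  by_cases hg : W.HasGoodReductionAtPrime 2
  · by_cases hd : ((2 : ℕ) : ℤ) ∣ W.frobeniusTrace 2
    · exact hSS W hcm hr0 ⟨hg, hd⟩
    · exact hOrd W hcm hr0 ⟨hg, hd⟩
  · by_cases hm : W.HasMultiplicativeReductionAtPrime 2
    · exact hMult W hcm hr0 hm
    · exact hAdd W hcm hr0 ⟨hg, hm⟩

/-- **`AdditiveOnlyResidualAtTwoNegDisc` (stmt-BirchSwinnertonDyer-24826, aside) ⟸ WALL row 1, BY NAME** (rank `0`, non-CM; the additive-only / `Δ < 0`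
clauses are idle).  CONDITIONAL; closes nothing. [cite: Miller2011LMS, Def. 1.1] -/
theorem additiveOnlyResidualAtTwoNegDisc_of_wallRows (hOrd : GoodOrdinaryRankZeroAtTwo) (hMult : MultiplicativeRankZeroAtTwo)
    (hSS : SupersingularRankZeroAtTwo) (hAdd : AdditiveRankZeroAtTwo) : AdditiveOnlyResidualAtTwoNegDisc := by
  intro W _ _ _ hcm hr0 _hρ _hT _hopt _hΔ _hno
  by_cases hg : W.HasGoodReductionAtPrime 2
  · by_cases hd : ((2 : ℕ) : ℤ) ∣ W.frobeniusTrace 2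
    · exact hSS W hcm hr0 ⟨hg, hd⟩
    · exact hOrd W hcm hr0 ⟨hg, hd⟩
  · by_cases hm : W.HasMultiplicativeReductionAtPrime 2
    · exact hMult W hcm hr0 hm
    · exact hAdd W hcm hr0 ⟨hg, hm⟩

end Summit.BirchSwinnertonDyer.BirchSwinnertonDyer.Theorems.GenusExact.Census.RankZeroResiduals

end
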